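import Literature.Probability.LatticeModels.SixVertexGFF

/-!
# The GFF multi-point functions `Ψ_k^{GFF}`: antisymmetry, vanishing on the diagonal, and the
# two-point function (DKLM 2026, Def. 2.6 and Part II §2.2)

H. Duminil-Copin, K. K. Kozlowski, P. Lammers, I. Manolescu, *Gaussian free field convergence of
the six-vertex model with `-1 ≤ Δ ≤ -1/2`*, arXiv:2603.06268 (2026) [DKLM2026SixVertexGFF]:

> **Definition 2.6 (1).** `Ψ_k^{GFF}(u) = ∑_{a, π} (-1)^{ε(a)} ∏_{ij ∈ π} G_{ℝ²}(aᵢ, aⱼ)` […] These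
> are precisely the correlation functions corresponding to a Gaussian process with covariance
> `G_{ℝ²}`.
> (Part II §2.2, properties characterising `Ψ_k = σ^k Ψ_k^{GFF}` as a function of `u₁`)
> **Value at one specific point:** `Ψ_k(u) = 0` at `u₁ = u₁'`.

For `gffKPoint k u = Ψ_k^{GFF}(u)` of `Literature/Probability/LatticeModels/SixVertexGFF.lean`
this file proves the elementary structural identities that mirror those of the six-vertex
`k`-point functions `Φ_k` (`kPoint_update_swap`, …, file `SixVertexGFFHeight.lean`):

* `gffKPoint_update_swap` — **antisymmetry** under `uᵢ ↔ uᵢ'` (the sign `(-1)^{ε(a)}` flips when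
  the choice at `i` is flipped);
* `gffKPoint_eq_zero_of_fst_eq_snd` — **`Ψ_k^{GFF}(u) = 0` whenever `uᵢ = uᵢ'`** for some `i`
  (the "value at one specific point" of Part II §2.2);
* `gffKPoint_two` — the **two-point function**
  `Ψ_2^{GFF}(u) = G(u₁', u₂') - G(u₁, u₂') - G(u₁', u₂) + G(u₁, u₂)`
  (`= 𝔼[(Γ(u₁') - Γ(u₁))(Γ(u₂') - Γ(u₂))]` for the GFF `Γ`);
* `harmonicAt_greenPlane_left/right`, **`harmonicAt_gffKPoint_update_fst/snd`** — the
  "Harmonicity" property of Part II §2.2 for `Ψ_k^{GFF}` itself: as a function of `uᵢ` (resp.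
  `uᵢ'`), `Ψ_k^{GFF}` is harmonic away from the points `uⱼ, uⱼ'`, `j ≠ i` (each pairing term
  contains `uᵢ` in at most one factor `G(uᵢ, ·)`, and `log |·|` is harmonic off `0`; Mathlib's
  `HarmonicAt`, `AnalyticAt.harmonicAt_log_norm`).

## References

* H. Duminil-Copin, K. K. Kozlowski, P. Lammers, I. Manolescu, arXiv:2603.06268 (2026), Def. 2.6,
  Part II §2.1 (Prop. 49) and §2.2. [DKLM2026SixVertexGFF]
-/

noncomputable section

open Finset InnerProductSpace

namespace Literature.Probability.LatticeModels.SixVertex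

/-! ### Flipping the choice `aᵢ ∈ {uᵢ, uᵢ'}` at one index -/

/-- Swapping `uᵢ ↔ uᵢ'` in `u` is the same as flipping the choice `a i` in `pickPoint`. [folklore] -/
theorem pickPoint_update_swap {k : ℕ} (u : Fin k → ℂ × ℂ) (i : Fin k) (a : Fin k → Bool)
    (j : Fin k) :
    pickPoint (Function.update u i ((u i).2, (u i).1)) a j =
      pickPoint u (Function.update a i (!a i)) j := by
  unfold pickPoint
  by_cases hj : j = i
  · subst hj
    simp only [Function.update_self]
    cases a j <;> simp
  · simp only [Function.update_of_ne hj]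

/-- Flipping one choice changes the parity of the number of unprimed choices. [folklore] -/
theorem neg_one_pow_card_filter_update_not {k : ℕ} (a : Fin k → Bool) (i : Fin k) :
    (-1 : ℝ) ^ (Finset.univ.filter fun j => Function.update a i (!a i) j = true).card =
      -(-1 : ℝ) ^ (Finset.univ.filter fun j => a j = true).card := by
  simp only [Finset.card_filter]
  have h1 : ∑ j : Fin k, (if Function.update a i (!a i) j = true then 1 else 0) =
      (if (!a i) = true then 1 else 0) + ∑ j ∈ Finset.univ \ {i}, (if a j = true then 1 else 0) := by
    rw [← Finset.sum_update_of_mem (Finset.mem_univ i)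
      (fun j => if a j = true then (1 : ℕ) else 0) (if (!a i) = true then 1 else 0)]
    refine Finset.sum_congr rfl fun j _ => ?_
    simp only [Function.update_apply]
    split_ifs <;> rfl
  have h2 : ∑ j : Fin k, (if a j = true then 1 else 0) =
      (if a i = true then 1 else 0) + ∑ j ∈ Finset.univ \ {i}, (if a j = true then 1 else 0) := by
    rw [← Finset.sum_update_of_mem (Finset.mem_univ i)
      (fun j => if a j = true then (1 : ℕ) else 0) (if a i = true then 1 else 0)]
    refine Finset.sum_congr rfl fun j _ => ?_
    simp only [Function.update_apply]
    split_ifs <;> first | rfl | (exfalso; simp_all)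
  rw [h1, h2]
  cases a i <;> simp <;> ring

/-- The inner sum over pairings, for a fixed choice `a`. [folklore] -/
theorem gffKPoint_eq_sum {k : ℕ} (u : Fin k → ℂ × ℂ) :
    gffKPoint k u = ∑ a : Fin k → Bool,
      (-1 : ℝ) ^ (Finset.univ.filter fun i => a i = true).card *
        ∑ σ ∈ fpfInvolutions k, ∏ i ∈ Finset.univ.filter (fun i : Fin k => i < σ i),
          greenPlane (pickPoint u a i) (pickPoint u a (σ i)) := by
  unfold gffKPoint
  refine Finset.sum_congr rfl fun a _ => ?_
  rw [Finset.mul_sum]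

/-! ### Antisymmetry and vanishing on the diagonal -/

/-- **Antisymmetry of `Ψ_k^{GFF}`** under swapping `uᵢ` and `uᵢ'` (flip the choice at `i`: the
products are unchanged and the sign `(-1)^{ε(a)}` flips). [cite: DKLM2026SixVertexGFF, Def. 2.6] -/
theorem gffKPoint_update_swap {k : ℕ} (u : Fin k → ℂ × ℂ) (i : Fin k) :
    gffKPoint k (Function.update u i ((u i).2, (u i).1)) = -gffKPoint k u := by
  rw [gffKPoint_eq_sum, gffKPoint_eq_sum]
  have hinv : Function.Involutive (fun a : Fin k → Bool => Function.update a i (!a i)) := by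
    intro a
    funext j
    by_cases hj : j = i
    · subst hj
      simp
    · simp [Function.update_of_ne hj]
  conv_rhs => rw [← Equiv.sum_comp (hinv.toPerm _)]
  rw [← Finset.sum_neg_distrib]
  refine Finset.sum_congr rfl fun a _ => ?_
  simp only [Function.Involutive.coe_toPerm]
  rw [neg_one_pow_card_filter_update_not, neg_mul, neg_neg]
  congr 1
  refine Finset.sum_congr rfl fun σ _ => Finset.prod_congr rfl fun j _ => ?_
  simp only [pickPoint_update_swap]

/-- **`Ψ_k^{GFF}(u) = 0` whenever `uᵢ = uᵢ'`** ("value at one specific point", Part II §2.2):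
swapping `uᵢ ↔ uᵢ'` does nothing to `u` but reverses the sign. [cite: DKLM2026SixVertexGFF, Part II §2.2] -/
theorem gffKPoint_eq_zero_of_fst_eq_snd {k : ℕ} (u : Fin k → ℂ × ℂ) (i : Fin k)
    (h : (u i).1 = (u i).2) : gffKPoint k u = 0 := by
  have hp : ((u i).2, (u i).1) = u i := Prod.ext h.symm h
  have hu : Function.update u i ((u i).2, (u i).1) = u := by
    rw [hp, Function.update_eq_self]
  have := gffKPoint_update_swap u i
  rw [hu] at this
  linarith

/-! ### The two-point function -/

/-- The fixed-point-free involutions of `Fin 2`: only the transposition. [folklore] -/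
theorem fpfInvolutions_two : fpfInvolutions 2 = {Equiv.swap 0 1} := by
  unfold fpfInvolutions
  decide

/-- **The GFF two-point function**:
`Ψ_2^{GFF}(u) = G(u₁', u₂') - G(u₁, u₂') - G(u₁', u₂) + G(u₁, u₂)`, the covariance
`𝔼[(Γ(u₁') - Γ(u₁))(Γ(u₂') - Γ(u₂))]` of GFF increments. [cite: DKLM2026SixVertexGFF, Def. 2.6] -/
theorem gffKPoint_two (u : Fin 2 → ℂ × ℂ) :
    gffKPoint 2 u = greenPlane (u 0).2 (u 1).2 - greenPlane (u 0).1 (u 1).2 -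
      greenPlane (u 0).2 (u 1).1 + greenPlane (u 0).1 (u 1).1 := by
  rw [gffKPoint, fpfInvolutions_two]
  have hfilt : (Finset.univ.filter fun i : Fin 2 => i < Equiv.swap (0 : Fin 2) 1 i) = {0} := by
    decide
  simp only [Finset.sum_singleton, hfilt, Finset.prod_singleton, Equiv.swap_apply_left]
  rw [Fintype.sum_equiv (piFinTwoEquiv fun _ => Bool)
    (fun a : Fin 2 → Bool => (-1 : ℝ) ^ (Finset.univ.filter fun i => a i = true).card *
      greenPlane (pickPoint u a 0) (pickPoint u a 1))
    (fun p : Bool × Bool =>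
      (-1 : ℝ) ^ ((if p.1 = true then 1 else 0) + (if p.2 = true then 1 else 0)) *
        greenPlane (if p.1 = true then (u 0).1 else (u 0).2)
          (if p.2 = true then (u 1).1 else (u 1).2))
    (fun a => by simp only [piFinTwoEquiv_apply, Finset.card_filter, Fin.sum_univ_two, pickPoint])]
  simp only [Fintype.sum_prod_type, Fintype.sum_bool]
  simp
  ring

/-! ### Harmonicity of `Ψ_k^{GFF}` in each variable (Part II §2.2, "Harmonicity") -/

/-- `x ↦ G_{ℝ²}(x, w)` is harmonic away from `w` (`log |·|` is harmonic off `0`).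
[cite: DKLM2026SixVertexGFF, §2.3] -/
theorem harmonicAt_greenPlane_left (w x₀ : ℂ) (hx : x₀ ≠ w) :
    HarmonicAt (fun x : ℂ => greenPlane x w) x₀ := by
  have h1 : AnalyticAt ℂ (fun x : ℂ => w - x) x₀ := analyticAt_const.sub analyticAt_id
  have h2 := (h1.harmonicAt_log_norm (sub_ne_zero.mpr (Ne.symm hx))).const_smul
    (c := -(1 / (2 * Real.pi)))
  have h3 : (fun x : ℂ => greenPlane x w) = -(1 / (2 * Real.pi)) • fun x : ℂ => Real.log ‖w - x‖ := by
    funext x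
    simp only [greenPlane, Pi.smul_apply, smul_eq_mul]
  rw [h3]
  exact h2

/-- `y ↦ G_{ℝ²}(w, y)` is harmonic away from `w`. [cite: DKLM2026SixVertexGFF, §2.3] -/
theorem harmonicAt_greenPlane_right (w x₀ : ℂ) (hx : x₀ ≠ w) :
    HarmonicAt (fun y : ℂ => greenPlane w y) x₀ := by
  have h1 : AnalyticAt ℂ (fun y : ℂ => y - w) x₀ := analyticAt_id.sub analyticAt_const
  have h2 := (h1.harmonicAt_log_norm (sub_ne_zero.mpr hx)).const_smul
    (c := -(1 / (2 * Real.pi)))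
  have h3 : (fun y : ℂ => greenPlane w y) = -(1 / (2 * Real.pi)) • fun y : ℂ => Real.log ‖y - w‖ := by
    funext y
    simp only [greenPlane, Pi.smul_apply, smul_eq_mul]
  rw [h3]
  exact h2

/-- Finite sums of harmonic functions are harmonic. [folklore] -/
theorem harmonicAt_finset_sum {ι : Type*} (s : Finset ι) (f : ι → ℂ → ℝ) (x₀ : ℂ)
    (h : ∀ i ∈ s, HarmonicAt (f i) x₀) : HarmonicAt (fun x => ∑ i ∈ s, f i x) x₀ := by
  classical
  induction s using Finset.induction_on with
  | empty =>
    simp only [Finset.sum_empty]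
    exact harmonicAt_const 0
  | insert a s ha ih =>
    have hfun : (fun x => ∑ i ∈ insert a s, f i x) = f a + fun x => ∑ i ∈ s, f i x := by
      funext x
      rw [Finset.sum_insert ha]
      rfl
    rw [hfun]
    exact (h a (Finset.mem_insert_self a s)).add
      (ih fun i hi => h i (Finset.mem_insert_of_mem hi))

/-- A scalar multiple (as a product with a constant) of a harmonic function is harmonic.
[folklore] -/
theorem harmonicAt_const_mul {f : ℂ → ℝ} {x₀ : ℂ} (c : ℝ) (h : HarmonicAt f x₀) :
    HarmonicAt (fun x => c * f x) x₀ := by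
  have : (fun x => c * f x) = c • f := by
    funext x
    simp
  rw [this]
  exact h.const_smul

/-- **Harmonicity of `Ψ_k^{GFF}` in the unprimed variable `uᵢ`**: for fixed other arguments,
`x ↦ Ψ_k^{GFF}(u with uᵢ := x)` is harmonic at every `x₀` distinct from the points `uⱼ, uⱼ'`,
`j ≠ i` (each pairing term contains `uᵢ` in at most the one factor `G(uᵢ, a_{π(i)})`).
This is the "Harmonicity" property used to characterise `σ^k Ψ_k^{GFF}` in Part II §2.2.
[cite: DKLM2026SixVertexGFF, Part II §2.2] -/
theorem harmonicAt_gffKPoint_update_fst {k : ℕ} (u : Fin k → ℂ × ℂ) (i₀ : Fin k) (x₀ : ℂ)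
    (hx : ∀ j, j ≠ i₀ → x₀ ≠ (u j).1 ∧ x₀ ≠ (u j).2) :
    HarmonicAt (fun x : ℂ => gffKPoint k (Function.update u i₀ (x, (u i₀).2))) x₀ := by
  classical
  unfold gffKPoint
  refine harmonicAt_finset_sum _ _ _ fun a _ => harmonicAt_finset_sum _ _ _ fun σ hσ => ?_
  simp only [fpfInvolutions, Finset.mem_filter, Finset.mem_univ, true_and] at hσ
  obtain ⟨hσσ, hfix⟩ := hσ
  have hσσ' : ∀ i, σ (σ i) = i := fun i => by
    have := congrArg (fun τ : Equiv.Perm (Fin k) => τ i) hσσ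
    simpa using this
  -- points away from `i₀` do not move
  have hpick : ∀ (x : ℂ) (j : Fin k), j ≠ i₀ →
      pickPoint (Function.update u i₀ (x, (u i₀).2)) a j = pickPoint u a j := by
    intro x j hj
    simp only [pickPoint, Function.update_of_ne hj]
  by_cases ha : a i₀ = true
  · -- the representative of the pair `{i₀, σ i₀}`
    set r : Fin k := if i₀ < σ i₀ then i₀ else σ i₀ with hr
    have hrS : r ∈ Finset.univ.filter (fun i : Fin k => i < σ i) := by
      simp only [Finset.mem_filter, Finset.mem_univ, true_and, hr]
      split_ifs with h
      · exact h
      · rw [hσσ']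
        exact lt_of_le_of_ne (not_lt.mp h) (hfix i₀)
    -- the other factors do not involve `i₀`
    have hother : ∀ i ∈ (Finset.univ.filter (fun i : Fin k => i < σ i)).erase r,
        i ≠ i₀ ∧ σ i ≠ i₀ := by
      intro i hi
      simp only [Finset.mem_erase, Finset.mem_filter, Finset.mem_univ, true_and] at hi
      obtain ⟨hir, hiσ⟩ := hi
      constructor
      · rintro rfl
        rw [hr, if_pos hiσ] at hir
        exact hir rfl
      · intro h
        have hi' : i = σ i₀ := by rw [← h, hσσ']
        subst hi'
        rw [hσσ'] at hiσ
        rw [hr, if_neg (not_lt.mpr hiσ.le)] at hir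
        exact hir rfl
    set w : ℂ := pickPoint u a (σ i₀) with hw
    have hw_ne : x₀ ≠ w := by
      have h := hx (σ i₀) (Ne.symm (hfix i₀) |> fun h => fun h' => h h'.symm)
      rw [hw, pickPoint]
      split_ifs
      · exact h.1
      · exact h.2
    -- the factor of the pair containing `i₀`, as a function of `x`
    have hfac : ∀ x : ℂ,
        greenPlane (pickPoint (Function.update u i₀ (x, (u i₀).2)) a r)
          (pickPoint (Function.update u i₀ (x, (u i₀).2)) a (σ r)) =
        if i₀ < σ i₀ then greenPlane x w else greenPlane w x := by
      intro x
      by_cases h : i₀ < σ i₀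
      · rw [if_pos h]
        have hr' : r = i₀ := by rw [hr, if_pos h]
        rw [hr', hpick x (σ i₀) (Ne.symm (hfix i₀) |> fun h => fun h' => h h'.symm), ← hw]
        simp [pickPoint, ha]
      · rw [if_neg h]
        have hr' : r = σ i₀ := by rw [hr, if_neg h]
        rw [hr', hσσ', hpick x (σ i₀) (Ne.symm (hfix i₀) |> fun h => fun h' => h h'.symm), ← hw]
        simp [pickPoint, ha]
    have hGfac : HarmonicAt (fun x : ℂ => if i₀ < σ i₀ then greenPlane x w else greenPlane w x) x₀ := by
      split_ifs
      · exact harmonicAt_greenPlane_left w x₀ hw_ne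
      · exact harmonicAt_greenPlane_right w x₀ hw_ne
    -- rewrite the term as (constant) * (pair factor)
    have hterm : (fun x : ℂ => (-1 : ℝ) ^ (Finset.univ.filter fun i => a i = true).card *
        ∏ i ∈ Finset.univ.filter (fun i : Fin k => i < σ i),
          greenPlane (pickPoint (Function.update u i₀ (x, (u i₀).2)) a i)
            (pickPoint (Function.update u i₀ (x, (u i₀).2)) a (σ i))) =
        fun x => ((-1 : ℝ) ^ (Finset.univ.filter fun i => a i = true).card *
          ∏ i ∈ (Finset.univ.filter (fun i : Fin k => i < σ i)).erase r,
            greenPlane (pickPoint u a i) (pickPoint u a (σ i))) *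
          (if i₀ < σ i₀ then greenPlane x w else greenPlane w x) := by
      funext x
      rw [← Finset.mul_prod_erase _ _ hrS, hfac x]
      have hrest : ∏ i ∈ (Finset.univ.filter (fun i : Fin k => i < σ i)).erase r,
          greenPlane (pickPoint (Function.update u i₀ (x, (u i₀).2)) a i)
            (pickPoint (Function.update u i₀ (x, (u i₀).2)) a (σ i)) =
          ∏ i ∈ (Finset.univ.filter (fun i : Fin k => i < σ i)).erase r,
            greenPlane (pickPoint u a i) (pickPoint u a (σ i)) := by
        refine Finset.prod_congr rfl fun i hi => ?_
        rw [hpick x i (hother i hi).1, hpick x (σ i) (hother i hi).2]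
      rw [hrest]
      ring
    rw [hterm]
    exact harmonicAt_const_mul _ hGfac
  · -- `a i₀ = false`: the term does not depend on `x`
    have hconst : ∀ (x : ℂ) (j : Fin k),
        pickPoint (Function.update u i₀ (x, (u i₀).2)) a j = pickPoint u a j := by
      intro x j
      by_cases hj : j = i₀
      · subst hj
        simp [pickPoint, ha]
      · exact hpick x j hj
    have hterm : (fun x : ℂ => (-1 : ℝ) ^ (Finset.univ.filter fun i => a i = true).card *
        ∏ i ∈ Finset.univ.filter (fun i : Fin k => i < σ i),
          greenPlane (pickPoint (Function.update u i₀ (x, (u i₀).2)) a i)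
            (pickPoint (Function.update u i₀ (x, (u i₀).2)) a (σ i))) =
        fun _ => (-1 : ℝ) ^ (Finset.univ.filter fun i => a i = true).card *
          ∏ i ∈ Finset.univ.filter (fun i : Fin k => i < σ i),
            greenPlane (pickPoint u a i) (pickPoint u a (σ i)) := by
      funext x
      simp only [hconst]
    rw [hterm]
    exact harmonicAt_const _

/-- **Harmonicity of `Ψ_k^{GFF}` in the primed variable `uᵢ'`** (from the unprimed case by
antisymmetry). [cite: DKLM2026SixVertexGFF, Part II §2.2] -/
theorem harmonicAt_gffKPoint_update_snd {k : ℕ} (u : Fin k → ℂ × ℂ) (i₀ : Fin k) (x₀ : ℂ)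
    (hx : ∀ j, j ≠ i₀ → x₀ ≠ (u j).1 ∧ x₀ ≠ (u j).2) :
    HarmonicAt (fun x : ℂ => gffKPoint k (Function.update u i₀ ((u i₀).1, x))) x₀ := by
  set u' : Fin k → ℂ × ℂ := Function.update u i₀ ((u i₀).2, (u i₀).1) with hu'
  have hx' : ∀ j, j ≠ i₀ → x₀ ≠ (u' j).1 ∧ x₀ ≠ (u' j).2 := by
    intro j hj
    rw [hu', Function.update_of_ne hj]
    exact hx j hj
  have h := (harmonicAt_gffKPoint_update_fst u' i₀ x₀ hx').neg
  have hfun : (fun x : ℂ => gffKPoint k (Function.update u i₀ ((u i₀).1, x))) =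
      -fun x : ℂ => gffKPoint k (Function.update u' i₀ (x, (u' i₀).2)) := by
    funext x
    simp only [Pi.neg_apply]
    have hs := gffKPoint_update_swap (Function.update u i₀ ((u i₀).1, x)) i₀
    simp only [Function.update_self, Function.update_idem] at hs
    rw [hu']
    simp only [Function.update_self, Function.update_idem]
    linarith
  rw [hfun]
  exact h

/-! ### Invariance of `Ψ_k^{GFF}` under permuting the pairs `{uᵢ, uᵢ'}` -/

/-- Products of a `τ`-invariant function over two systems of representatives of the orbits of
a fixed-point-free involution `τ` agree. [folklore] -/
theorem prod_eq_prod_of_involution_sections {α M : Type*} [DecidableEq α] [CommMonoid M]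
    (τ : Equiv.Perm α) (hτ : ∀ x, τ (τ x) = x) (g : α → M) (hg : ∀ x, g (τ x) = g x)
    (R R' : Finset α) (hR : ∀ x, x ∈ R ↔ τ x ∉ R) (hR' : ∀ x, x ∈ R' ↔ τ x ∉ R') :
    ∏ x ∈ R, g x = ∏ x ∈ R', g x := by
  refine Finset.prod_nbij' (fun x => if x ∈ R' then x else τ x)
    (fun y => if y ∈ R then y else τ y) (fun x _ => ?_) (fun y _ => ?_) (fun x hx => ?_)
    (fun y hy => ?_) (fun x _ => ?_)
  · by_cases h : x ∈ R'
    · rw [if_pos h]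
      exact h
    · rw [if_neg h]
      exact not_not.mp ((hR' x).not.mp h)
  · by_cases h : y ∈ R
    · rw [if_pos h]
      exact h
    · rw [if_neg h]
      exact not_not.mp ((hR y).not.mp h)
  · by_cases h : x ∈ R'
    · rw [if_pos h, if_pos hx]
    · rw [if_neg h, if_neg ((hR x).1 hx), hτ]
  · by_cases h : y ∈ R
    · rw [if_pos h, if_pos hy]
    · rw [if_neg h, if_neg ((hR' y).1 hy), hτ]
  · by_cases h : x ∈ R'
    · rw [if_pos h]
    · rw [if_neg h, hg]

/-- The number of unprimed choices is invariant under relabelling the indices. [folklore] -/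
theorem card_filter_comp_perm {k : ℕ} (b : Fin k → Bool) (π : Equiv.Perm (Fin k)) :
    (Finset.univ.filter fun i => b (π i) = true).card = (Finset.univ.filter fun j => b j = true).card := by
  refine Finset.card_bij (fun i _ => π i) (fun i hi => ?_) (fun i₁ _ i₂ _ h => π.injective h)
    (fun j hj => ⟨π.symm j, ?_, by simp⟩)
  · simpa using hi
  · simpa using hj

/-- **Invariance of `Ψ_k^{GFF}` under permuting the pairs** `(uᵢ, uᵢ') ↦ (u_{π i}, u_{π i}')`
(relabel the choices `a` and conjugate the pairings `π`; the product over a pairing does not depend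
on the chosen representatives of the pairs since `G_{ℝ²}` is symmetric).
[cite: DKLM2026SixVertexGFF, Def. 2.6] -/
theorem gffKPoint_comp_perm {k : ℕ} (u : Fin k → ℂ × ℂ) (π : Equiv.Perm (Fin k)) :
    gffKPoint k (u ∘ π) = gffKPoint k u := by
  classical
  rw [gffKPoint_eq_sum, gffKPoint_eq_sum]
  -- relabel the choices: `a ↦ a ∘ π⁻¹`
  rw [← Equiv.sum_comp (π.arrowCongr (Equiv.refl Bool)).symm]
  refine Finset.sum_congr rfl fun b _ => ?_
  have hab : ∀ i, ((π.arrowCongr (Equiv.refl Bool)).symm b) i = b (π i) := fun i => by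
    simp [Equiv.arrowCongr]
  have hpick : ∀ i, pickPoint (u ∘ π) ((π.arrowCongr (Equiv.refl Bool)).symm b) i =
      pickPoint u b (π i) := fun i => by
    simp only [pickPoint, hab, Function.comp_apply]
  simp only [hpick]
  have hcard : (Finset.univ.filter fun i => ((π.arrowCongr (Equiv.refl Bool)).symm b) i = true).card =
      (Finset.univ.filter fun j => b j = true).card := by
    simp only [hab]
    exact card_filter_comp_perm b π
  rw [hcard]
  congr 1
  -- conjugate the pairings: `σ ↦ π σ π⁻¹`
  refine Finset.sum_nbij' (fun σ => π * σ * π⁻¹) (fun τ => π⁻¹ * τ * π) (fun σ hσ => ?_)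
    (fun τ hτ => ?_) (fun σ _ => by group) (fun τ _ => by group) (fun σ hσ => ?_)
  · simp only [fpfInvolutions, Finset.mem_filter, Finset.mem_univ, true_and] at hσ ⊢
    refine ⟨?_, fun i => ?_⟩
    · calc π * σ * π⁻¹ * (π * σ * π⁻¹) = π * (σ * σ) * π⁻¹ := by group
        _ = 1 := by rw [hσ.1]; group
    · simp only [Equiv.Perm.coe_mul, Function.comp_apply]
      intro h
      exact hσ.2 (π⁻¹ i) (by simpa using congrArg (fun y => π⁻¹ y) h)
  · simp only [fpfInvolutions, Finset.mem_filter, Finset.mem_univ, true_and] at hτ ⊢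
    refine ⟨?_, fun i => ?_⟩
    · calc π⁻¹ * τ * π * (π⁻¹ * τ * π) = π⁻¹ * (τ * τ) * π := by group
        _ = 1 := by rw [hτ.1]; group
    · simp only [Equiv.Perm.coe_mul, Function.comp_apply]
      intro h
      exact hτ.2 (π i) (by simpa using congrArg π h)
  · -- the product over representatives of the pairs
    simp only [fpfInvolutions, Finset.mem_filter, Finset.mem_univ, true_and] at hσ
    obtain ⟨hσσ, hfix⟩ := hσ
    have hσσ' : ∀ i, σ (σ i) = i := fun i => by
      have := congrArg (fun ρ : Equiv.Perm (Fin k) => ρ i) hσσ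
      simpa using this
    set τ : Equiv.Perm (Fin k) := π * σ * π⁻¹ with hτdef
    have hτ : ∀ x, τ (τ x) = x := fun x => by simp [hτdef, hσσ']
    have hτfix : ∀ x, τ x ≠ x := fun x h => hfix (π⁻¹ x) (by
      have := congrArg (fun y => π⁻¹ y) h
      simpa [hτdef] using this)
    -- rewrite the left product as a product over `π '' S_σ`
    have hmap : ∏ i ∈ Finset.univ.filter (fun i : Fin k => i < σ i),
        greenPlane (pickPoint u b (π i)) (pickPoint u b (π (σ i))) =
        ∏ x ∈ (Finset.univ.filter (fun i : Fin k => i < σ i)).map π.toEmbedding,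
          greenPlane (pickPoint u b x) (pickPoint u b (τ x)) := by
      rw [Finset.prod_map]
      refine Finset.prod_congr rfl fun i _ => ?_
      simp [hτdef]
    rw [hmap]
    refine prod_eq_prod_of_involution_sections τ hτ
      (fun x => greenPlane (pickPoint u b x) (pickPoint u b (τ x))) (fun x => ?_) _ _
      (fun x => ?_) (fun x => ?_)
    · -- symmetry of `G`
      rw [hτ]
      simp only [greenPlane, norm_sub_rev]
    · simp only [Finset.mem_map_equiv, Finset.mem_filter, Finset.mem_univ, true_and]
      have h1 : π.symm (τ x) = σ (π.symm x) := by simp [hτdef]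
      rw [h1, hσσ']
      constructor
      · intro h h'
        exact lt_asymm h h'
      · intro h
        exact lt_of_le_of_ne (not_lt.mp h) (Ne.symm (hfix _))
    · simp only [Finset.mem_filter, Finset.mem_univ, true_and, hτ]
      constructor
      · intro h h'
        exact lt_asymm h h'
      · intro h
        exact lt_of_le_of_ne (not_lt.mp h) (Ne.symm (hτfix x))

end Literature.Probability.LatticeModels.SixVertex

end
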